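import Literature.Probability.Percolation.TargetExplorationHK
import Literature.Probability.Percolation.TargetExplorationSwap
import HarnessLib

/-!
# Marker dominance, step P_v: hybrid bookkeeping for the cluster-conditioning lemma

Finitary calculus
`PrW / Pr2W / condSumW` of `DecisionTreeWeighted.lean`; `S(C₁)` a self-determined revealment (e.g. the
revealed set of the stopped target exploration, `TargetExploration.revealedAt`).

* `Pr2W_hybrid_eq_sum_condSumW` — `P⊗P{C₁ ∈ X, C₁ →_S C₂ ∈ B} = Σ_{K} wt(K)·1_X(K)·condSum_S(B)(K)`
  (the hybrid event as a first-configuration average of the conditional sum; [cite: Gladkov2024, §2 and proof of Thm. 5.2] bookkeeping).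
* `sum_condSumW_ge` — with Gladkov's decision-tree Harris–Kleitman inequality for the target exploration
  (`TargetExploration.PrW_mul_PrW_le_Pr2W_hybrid`): `Σ_K wt(K) 1_X(K) condSum(F)(K) ≥ P(X)·P(F)` for up-closed `X, F`
  ("cluster-conditional Harris": the conditional expectations of two increasing events given the exploration
  σ-field are positively correlated).
-/

noncomputable section

open Classical

namespace Summit.CriticalPhenomena.PercolationContinuityZ3.Theorems

namespace MarkerDominancePv

open Finset Literature.Probability.Percolation Literature.Probability.Percolation.DecisionTree
  Literature.Probability.Percolation.TargetExploration

variable {ι : Type*} [DecidableEq ι]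

/-- **The hybrid event as a first-configuration average of the conditional sum**:
`P⊗P{(C₁,C₂) : C₁ ∈ X, C₁ →_{S(C₁)} C₂ ∈ B} = Σ_{K ⊆ D} wt(K) · 1_X(K) · condSum_S(B)(K)`. [folklore] -/
theorem Pr2W_hybrid_eq_sum_condSumW (D : Finset ι) (p : ι → ℝ) (Fm : Finset ι → Finset ι)
    (X B : Set (Finset ι)) :
    Pr2W D p {c | c.1 ∈ X ∧ splice (Fm c.1) c.1 c.2 ∈ B} =
      ∑ K ∈ D.powerset, wtW D p K * ind X K * condSumW D p Fm B K := by
  -- iterated sum: first configuration, then the slice (as `TargetExploration.Pr2W_eq_sum_mul_PrW`)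
  have hiter : Pr2W D p {c | c.1 ∈ X ∧ splice (Fm c.1) c.1 c.2 ∈ B} =
      ∑ S ∈ D.powerset, wtW D p S *
        PrW D p {T | (S, T) ∈ {c : Finset ι × Finset ι | c.1 ∈ X ∧ splice (Fm c.1) c.1 c.2 ∈ B}} := by
    unfold Pr2W PrW wt2W
    rw [Finset.sum_product]
    refine Finset.sum_congr rfl fun S _ => ?_
    rw [Finset.mul_sum]
    refine Finset.sum_congr rfl fun T _ => ?_
    by_cases h : (S, T) ∈ {c : Finset ι × Finset ι | c.1 ∈ X ∧ splice (Fm c.1) c.1 c.2 ∈ B}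
    · have h' : T ∈ ({T : Finset ι | (S, T) ∈
          {c : Finset ι × Finset ι | c.1 ∈ X ∧ splice (Fm c.1) c.1 c.2 ∈ B}} : Set (Finset ι)) := h
      rw [Set.indicator_of_mem h, Set.indicator_of_mem h']
    · have h' : T ∉ ({T : Finset ι | (S, T) ∈
          {c : Finset ι × Finset ι | c.1 ∈ X ∧ splice (Fm c.1) c.1 c.2 ∈ B}} : Set (Finset ι)) := h
      rw [Set.indicator_of_notMem h, Set.indicator_of_notMem h', mul_zero]
  rw [hiter]
  refine Finset.sum_congr rfl fun K _ => ?_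
  by_cases hK : K ∈ X
  · rw [ind_of_mem hK, mul_one]
    congr 1
    unfold PrW condSumW
    refine Finset.sum_congr rfl fun T _ => ?_
    rw [indicator_eq_mul_ind]
    have : ({T : Finset ι | (K, T) ∈ {c : Finset ι × Finset ι | c.1 ∈ X ∧ splice (Fm c.1) c.1 c.2 ∈ B}} :
        Set (Finset ι)) = {T | splice (Fm K) K T ∈ B} := by
      ext T; simp [hK]
    rw [this]
    by_cases hT : splice (Fm K) K T ∈ B
    · rw [ind_of_mem hT, ind_of_mem (show T ∈ {T | splice (Fm K) K T ∈ B} from hT)]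
    · rw [ind_of_not_mem hT, ind_of_not_mem (show T ∉ {T | splice (Fm K) K T ∈ B} from hT)]
  · rw [ind_of_not_mem hK, mul_zero, zero_mul]
    have : ({T : Finset ι | (K, T) ∈ {c : Finset ι × Finset ι | c.1 ∈ X ∧ splice (Fm c.1) c.1 c.2 ∈ B}} :
        Set (Finset ι)) = ∅ := by
      ext T; simp [hK]
    rw [this]
    unfold PrW
    simp

end MarkerDominancePv

section Explore

open Finset Literature.Probability.Percolation Literature.Probability.Percolation.DecisionTree
  Literature.Probability.Percolation.TargetExploration MarkerDominancePv

variable {V : Type*} [Fintype V] [DecidableEq V]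

/-- **Cluster-conditional Harris for the stopped target exploration** (Gladkov's Theorem 3.2 in
conditional-sum form): for up-closed `X, F` and weights in `[0,1]`,
`Σ_K wt(K)·1_X(K)·condSum_{S}(F)(K) ≥ P(X)·P(F)`, `S = revealedAt D A o`.
[cite: Gladkov2024, Thm. 3.2 (p. 4) — corollary] -/
theorem MarkerDominancePv.sum_condSumW_ge (D : Finset (Sym2 V)) (A : Finset V) (o : V) {p : Sym2 V → ℝ}
    (hp0 : ∀ e, 0 ≤ p e) (hp1 : ∀ e, p e ≤ 1) {X F : Set (Finset (Sym2 V))} (hX : IsUpperSet X)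
    (hF : IsUpperSet F) :
    PrW D p X * PrW D p F ≤
      ∑ K ∈ D.powerset, wtW D p K * ind X K * condSumW D p (revealedAt D A o) F K := by
  rw [← Pr2W_hybrid_eq_sum_condSumW]
  exact PrW_mul_PrW_le_Pr2W_hybrid D A o hp0 hp1 hX hF

end Explore

end Summit.CriticalPhenomena.PercolationContinuityZ3.Theorems

namespace Summit.CriticalPhenomena.PercolationContinuityZ3.Theorems

namespace MarkerDominancePv

/-! ### Cylinder factorisation (the hybrid's law off the revealed set is the product law) -/

open Finset Literature.Probability.Percolation Literature.Probability.Percolation.DecisionTree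

variable {ι : Type*} [DecidableEq ι]

/-- **Cylinder factorisation of the conditional sum** (the law of the hybrid off the revealed set is the
product law): for the constant revealment `F`, `P(cyl_F(K)) · Σ_T wt(T) 1_B(K →_F T) = P(B ∩ cyl_F(K))`.
[cite: Gladkov2024, Lemma 3.1 — corollary (swap along a fixed set)] -/
theorem PrW_cyl_mul_condSumW (D : Finset ι) (p : ι → ℝ) (F K : Finset ι) (B : Set (Finset ι)) :
    PrW D p {K' : Finset ι | ∀ i ∈ F, (i ∈ K' ↔ i ∈ K)} * condSumW D p (fun _ => F) B K =
      PrW D p (B ∩ {K' : Finset ι | ∀ i ∈ F, (i ∈ K' ↔ i ∈ K)}) := by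
  -- both sides as pair sums; the swap along the fixed set `F` exchanges them
  set cy : Set (Finset ι) := {K' : Finset ι | ∀ i ∈ F, (i ∈ K' ↔ i ∈ K)} with hcy
  have mem_cy : ∀ {K' : Finset ι}, K' ∈ cy ↔ ∀ i ∈ F, (i ∈ K' ↔ i ∈ K) := fun {K'} => Iff.rfl
  have hF : SelfDetermined (fun _ : Finset ι => F) := fun _ _ _ => rfl
  have lhs : PrW D p (cy) * condSumW D p (fun _ => F) B K =
      ∑ x ∈ D.powerset ×ˢ D.powerset, wt2W D p x * (ind (cy) x.1 * ind B (splice F x.1 x.2)) := by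
    unfold PrW condSumW wt2W
    rw [Finset.sum_product, Finset.sum_mul]
    refine Finset.sum_congr rfl fun S _ => ?_
    rw [indicator_eq_mul_ind, Finset.mul_sum]
    refine Finset.sum_congr rfl fun T _ => ?_
    by_cases hS : S ∈ cy
    · have hsp : splice F S T = splice F K T :=
        splice_congr_left (fun i hi => (mem_cy.1 hS) i hi) T
      rw [hsp, ind_of_mem hS]; ring
    · rw [ind_of_not_mem hS]; ring
  have rhs : PrW D p (B ∩ cy) =
      ∑ x ∈ D.powerset ×ˢ D.powerset, wt2W D p x * (ind (cy) x.1 * ind B x.1) := by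
    unfold wt2W
    rw [Finset.sum_product]
    unfold PrW
    refine Finset.sum_congr rfl fun S _ => ?_
    rw [indicator_eq_mul_ind]
    have h1 : ∑ T ∈ D.powerset, wtW D p S * wtW D p T * (ind (cy) S * ind B S) =
        wtW D p S * (ind (cy) S * ind B S) * ∑ T ∈ D.powerset, wtW D p T := by
      rw [Finset.mul_sum]
      refine Finset.sum_congr rfl fun T _ => by ring
    rw [h1, sum_wtW, mul_one]
    by_cases hS : S ∈ cy
    · by_cases hB : S ∈ B
      · rw [ind_of_mem hS, ind_of_mem hB, ind_of_mem (Set.mem_inter hB hS)]; ring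
      · rw [ind_of_not_mem hB, ind_of_not_mem (fun h => hB h.1)]; ring
    · rw [ind_of_not_mem hS, ind_of_not_mem (fun h => hS h.2)]; ring
  rw [lhs, rhs, sum_pair_reindexW D p hF (fun x => ind (cy) x.1 * ind B x.1)]
  refine Finset.sum_congr rfl fun x _ => ?_
  -- swapPair (fun _ => F) x = (splice F x.1 x.2, splice F x.2 x.1); the first component agrees with x.1 on F
  have hc : ind (cy) (splice F x.1 x.2) = ind (cy) x.1 := by
    by_cases hS : x.1 ∈ cy
    · rw [ind_of_mem hS, ind_of_mem]
      exact mem_cy.2 fun i hi => (splice_agree F x.1 x.2 i hi).trans ((mem_cy.1 hS) i hi)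
    · rw [ind_of_not_mem hS, ind_of_not_mem]
      exact fun h => hS fun i hi => (splice_agree F x.1 x.2 i hi).symm.trans (h i hi)
  show wt2W D p x * (ind (cy) x.1 * ind B (splice F x.1 x.2)) =
    wt2W D p x * (ind (cy) (swapPair (fun _ => F) x).1 * ind B (swapPair (fun _ => F) x).1)
  simp only [swapPair, hc]

end MarkerDominancePv

end Summit.CriticalPhenomena.PercolationContinuityZ3.Theorems

end
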